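import Summits.Ventures.CertifiedManyBodySolver.Downfold.EmeryOrbitalWeightFaceDirBox
import Summits.Ventures.CertifiedManyBodySolver.Downfold.EmeryVanHoveSubBox
import Summits.Ventures.CertifiedManyBodySolver.Downfold.EmeryVanHoveTableA
import Summits.Ventures.CertifiedManyBodySolver.Downfold.EmeryVanHoveTableE
import Summits.Ventures.CertifiedManyBodySolver.Downfold.EmeryFermiFaceDirPointsHg1201P10NH116S1
import Summits.Ventures.CertifiedManyBodySolver.Downfold.EmeryFermiFaceDirPointsHg1201P10NH116S2
import HarnessLib

/-!
# THE ANTINODAL FERMI-SURFACE Cu-d WEIGHT OVER THE TYPED 3BE BOX `emeryBoxHg1201P10 (EmeryBoxesPressure)` AT FILLING n_H = 1.16 (ν = 21/50), regime-free rule v2 — the kinematic leg of the UPPER member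
# `U_B∣full(w_antinode)` of the weak band-level `U` bracket read over a box where the v1 rule's antinodal charge-transfer regime FAILS at the low-Δ corners
# (INFL-3to1-B §B.90 (j); kernel `EmeryOrbitalWeightFaceDirBox`; router/EMERY-FS-WEIGHT-BRACKETS.tsv / OBJECT-E-BUDGET.tsv §C)

Venture CertifiedManyBodySolver, cell `pub/hubbard-downfold` (stage S1), seat hubbard-downfold-mod-4 (technique B, g39); namespace
`Summit.Ventures.CertifiedManyBodySolver.Downfold.Emery`. Everything PROVED (0 sorry). WHAT THIS IS NOT: a statement about the material — the typed box (HgBa₂CuO₄ @10 GPa (box #19 @10))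
is SCREENING-GRADE; `U = 0` one-body kinematics of the σ model; the `U_B` arithmetic that consumes the window is DERIVED context on the MEAN-FIELD annex (R-B17).

For every member θ = (Δ, t_pd, t_pp, t_pp′) ∈ [1.15, 2.5] × [1.39, 1.54] × [0.68, 0.79] × [0.1156, 0.1156] eV at filling ν = 21/50, the Cu-d weight of the ANTINODAL Bloch state,
`dWeightFace θ (fermiEnergyOf θ ν)`, lies in the window below. DEVICE (v2): `W(θ) = W(Δ/t_pd, 1, t_pp/t_pd, t_pp′/t_pd)` (scaling law); the t_pd range is cut into 2 slabs; on each
normalised slab the v2 CORNER RULE `dWeightFace_fermiEnergyOf_mem_Icc_of_mem_box3_dir_num`: Δ ↑ at fixed filling WITHOUT the regime (region-wide directional certificate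
`faceDir_nonneg_of_mem_region`, κ₀ = 1/10, + the Fermi-energy slope law κ = 1/10 + mean value theorem), t_pp ↓, t_pp′ ↑ only at the upper corner (regime margin R2 there),
lower end `t_pp′`-decoupled (`dWeightFaceLoDec` at `E_h`); hole-likeness from the slab's `vhBoxCheck` + the Ψ table; two K = 384 Fermi-energy brackets per slab
(`EmeryFermiFaceDirPointsHg1201P10NH116S<k>`). The slab corners are VIRTUAL (not members): the window is a sound ENCLOSURE (lower end ≈ 0.02 below the v1 virtual-corner value).

| t_pd slab (eV) | normalised slab Δ/t_pd × t_pp/t_pd × t_pp′/t_pd | q₁ (vhBoxCheck) ≥ table point | E_h | E_v | margins (R2, 1 − κ − w̄_axis) | **w_face window** |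
|---|---|---|---|---|---|---|
| [1.39, 1.465] | [0.785, 1.799] × [0.4642, 0.5683] × [0.07891, 0.08317] | 0.4923 ≥ 49/100 (Ψ ≤ 0.3944) | 1.6411 | 1.2287 | +0.838, +0.166 | **[0.5964, 0.7273]** |
| [1.465, 1.54] | [0.7468, 1.706] × [0.4416, 0.5392] × [0.07506, 0.07891] | 0.4747 ≥ 93/200 (Ψ ≤ 0.3977) | 1.651 | 1.2552 | +0.880, +0.176 | **[0.594, 0.7186]** |
| **whole box** | (hull of the slabs) | | | | | **[0.594, 0.7273]** |

Sources: three-band model [HybertsenSchluterChristensen1989, Eq. (1)]; face point of the bilinear contour [AndersenEtAl1995, §6]; [folklore] algebra.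
-/

noncomputable section

namespace Summit.Ventures.CertifiedManyBodySolver.Downfold.Emery

open Real Set

/-- **Slab 1 (t_pd ∈ [1.39, 1.465] eV) of `emeryBoxHg1201P10 (EmeryBoxesPressure)`, ν = 21/50: the antinodal Fermi-surface Cu-d weight of every member lies in `[0.5964, 0.7273]`**
(normalised-slab v2 corner rule; brackets `faceDirPt_Hg1201P10_nH116_s1_lo_br` / `_hi_br`). [folklore] -/
theorem hg1201P10Box_dWeightFaceDir_nH116_s1 {Δ a b c : ℝ} (hΔ : Δ ∈ Icc ((23 : ℝ) / 20) ((5 : ℝ) / 2)) (ha : a ∈ Icc ((139 : ℝ) / 100) ((293 : ℝ) / 200)) (hb : b ∈ Icc ((17 : ℝ) / 25) ((79 : ℝ) / 100)) (hc : c ∈ Icc ((289 : ℝ) / 2500) ((289 : ℝ) / 2500)) :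
    dWeightFace Δ a b c (fermiEnergyOf Δ a b c ((21 : ℝ) / 50)) ∈ Icc ((1491 : ℝ) / 2500) ((7273 : ℝ) / 10000) := by
  have ha0 : 0 < a := lt_of_lt_of_le (by norm_num) ha.1
  rw [dWeightFace_fermiEnergyOf_eq_ratios ha0]
  have hΔn : Δ / a ∈ Icc ((230 : ℝ) / 293) ((250 : ℝ) / 139) := by
    constructor
    · rw [le_div_iff₀ ha0]; linarith [hΔ.1, ha.2]
    · rw [div_le_iff₀ ha0]; linarith [hΔ.2, ha.1]
  have hbn : b / a ∈ Icc ((136 : ℝ) / 293) ((79 : ℝ) / 139) := by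
    constructor
    · rw [le_div_iff₀ ha0]; linarith [hb.1, ha.2]
    · rw [div_le_iff₀ ha0]; linarith [hb.2, ha.1]
  have hcn : c / a ∈ Icc ((578 : ℝ) / 7325) ((289 : ℝ) / 3475) := by
    constructor
    · rw [le_div_iff₀ ha0]; linarith [hc.1, ha.2]
    · rw [div_le_iff₀ ha0]; linarith [hc.2, ha.1]
  have hVH : ∀ Δ' b' c' : ℝ, Δ' ∈ Icc ((230 : ℝ) / 293) ((250 : ℝ) / 139) → b' ∈ Icc ((136 : ℝ) / 293) ((79 : ℝ) / 139) → c' ∈ Icc ((578 : ℝ) / 7325) ((289 : ℝ) / 3475) →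
      1 - 2 * ((21 : ℝ) / 50) ≤ xVH Δ' 1 b' c' := by
    intro Δ' b' c' hΔ' hb' hc'
    have h := xVH_window_of_vhBoxCheck (Δ₁ := ((230 : ℚ) / 293)) (Δ₂ := ((250 : ℚ) / 139)) (a₁ := (1 : ℚ)) (a₂ := (1 : ℚ)) (b₁ := ((136 : ℚ) / 293)) (b₂ := ((79 : ℚ) / 139))
      (c₁ := ((578 : ℚ) / 7325)) (c₂ := ((289 : ℚ) / 3475)) (v₁ := ((2401 : ℚ) / 2000)) (v₂ := ((15241 : ℚ) / 10000)) (e := ((15177 : ℚ) / 10000)) (E := ((12051 : ℚ) / 10000))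
      (q₁ := ((4923 : ℚ) / 10000)) (q₂ := ((8861 : ℚ) / 10000)) (by decide +kernel)
      (Δ := Δ') (tpd := 1) (tpp := b') (c := c') (by simpa using hΔ') (by simp) (by simpa using hb') (by simpa using hc')
    obtain ⟨-, -, -, -, -, hwin⟩ := h
    push_cast at hwin
    have ht := vhFrac_49_100
    have hmono := vhFrac_anti (show (49 / 100 : ℝ) ≤ ((4923 : ℝ) / 10000) by norm_num)
    have hnu : ((58150 : ℝ) / 147456) ≤ ((21 : ℝ) / 50) := by norm_num
    linarith [hwin.1, ht.2]
  have hEh := (fermiEnergyOf_of_pointBracketCheck faceDirPt_Hg1201P10_nH116_s1_lo_br (by norm_num) (by norm_num) (by norm_num) (ν := (21/50 : ℝ))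
    (by push_cast; exact ⟨le_rfl, le_rfl⟩)).2
  have hEv := (fermiEnergyOf_of_pointBracketCheck faceDirPt_Hg1201P10_nH116_s1_hi_br (by norm_num) (by norm_num) (by norm_num) (ν := (21/50 : ℝ))
    (by push_cast; exact ⟨le_rfl, le_rfl⟩)).2
  push_cast at hEh hEv
  refine dWeightFace_fermiEnergyOf_mem_Icc_of_mem_box3_dir_num (Eh := ((16411 : ℝ) / 10000)) (Ev := ((12287 : ℝ) / 10000)) (Elow := ((12187 : ℝ) / 10000)) (κ₀ := 1 / 10) (κ := 1 / 10)
    (by norm_num) one_pos (by norm_num) (by norm_num) (by norm_num) hΔn hbn hcn (by norm_num) (by norm_num) hVH hEh.2 (by norm_num)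
    (by norm_num [faceU, fsD, fsN, cA]) (by norm_num [faceU, fsD, fsN, cA]) (by norm_num [faceU, fsD, fsN, cA]) (by norm_num [faceU, fsD, fsN, cA])
    hEv.1 (by norm_num) (by norm_num) (by norm_num [faceG]) (by norm_num) (by norm_num) (by norm_num) le_rfl (by norm_num [dWeightAxisCF])
    (by norm_num) (by norm_num) ?_ (by norm_num [dWeightFaceLoDec, faceRUp, faceN]) (by norm_num [dWeightFaceCF, faceN, faceR, fsN])
  intro D B C e hD hB hC he hG
  exact faceDir_nonneg_of_mem_region ⟨le_trans (by norm_num) hD.1, le_trans hD.2 (by norm_num)⟩ ⟨le_trans (by norm_num) he.1, le_trans he.2 (by norm_num)⟩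
    ⟨le_trans (by norm_num) hB.1, le_trans hB.2 (by norm_num)⟩ ⟨le_trans (by norm_num) hC.1, le_trans hC.2 (by norm_num)⟩ hG

/-- **Slab 2 (t_pd ∈ [1.465, 1.54] eV) of `emeryBoxHg1201P10 (EmeryBoxesPressure)`, ν = 21/50: the antinodal Fermi-surface Cu-d weight of every member lies in `[0.594, 0.7186]`**
(normalised-slab v2 corner rule; brackets `faceDirPt_Hg1201P10_nH116_s2_lo_br` / `_hi_br`). [folklore] -/
theorem hg1201P10Box_dWeightFaceDir_nH116_s2 {Δ a b c : ℝ} (hΔ : Δ ∈ Icc ((23 : ℝ) / 20) ((5 : ℝ) / 2)) (ha : a ∈ Icc ((293 : ℝ) / 200) ((77 : ℝ) / 50)) (hb : b ∈ Icc ((17 : ℝ) / 25) ((79 : ℝ) / 100)) (hc : c ∈ Icc ((289 : ℝ) / 2500) ((289 : ℝ) / 2500)) :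
    dWeightFace Δ a b c (fermiEnergyOf Δ a b c ((21 : ℝ) / 50)) ∈ Icc ((297 : ℝ) / 500) ((3593 : ℝ) / 5000) := by
  have ha0 : 0 < a := lt_of_lt_of_le (by norm_num) ha.1
  rw [dWeightFace_fermiEnergyOf_eq_ratios ha0]
  have hΔn : Δ / a ∈ Icc ((115 : ℝ) / 154) ((500 : ℝ) / 293) := by
    constructor
    · rw [le_div_iff₀ ha0]; linarith [hΔ.1, ha.2]
    · rw [div_le_iff₀ ha0]; linarith [hΔ.2, ha.1]
  have hbn : b / a ∈ Icc ((34 : ℝ) / 77) ((158 : ℝ) / 293) := by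
    constructor
    · rw [le_div_iff₀ ha0]; linarith [hb.1, ha.2]
    · rw [div_le_iff₀ ha0]; linarith [hb.2, ha.1]
  have hcn : c / a ∈ Icc ((289 : ℝ) / 3850) ((578 : ℝ) / 7325) := by
    constructor
    · rw [le_div_iff₀ ha0]; linarith [hc.1, ha.2]
    · rw [div_le_iff₀ ha0]; linarith [hc.2, ha.1]
  have hVH : ∀ Δ' b' c' : ℝ, Δ' ∈ Icc ((115 : ℝ) / 154) ((500 : ℝ) / 293) → b' ∈ Icc ((34 : ℝ) / 77) ((158 : ℝ) / 293) → c' ∈ Icc ((289 : ℝ) / 3850) ((578 : ℝ) / 7325) →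
      1 - 2 * ((21 : ℝ) / 50) ≤ xVH Δ' 1 b' c' := by
    intro Δ' b' c' hΔ' hb' hc'
    have h := xVH_window_of_vhBoxCheck (Δ₁ := ((115 : ℚ) / 154)) (Δ₂ := ((500 : ℚ) / 293)) (a₁ := (1 : ℚ)) (a₂ := (1 : ℚ)) (b₁ := ((34 : ℚ) / 77)) (b₂ := ((158 : ℚ) / 293))
      (c₁ := ((289 : ℚ) / 3850)) (c₂ := ((578 : ℚ) / 7325)) (v₁ := ((12299 : ℚ) / 10000)) (v₂ := ((15439 : ℚ) / 10000)) (e := ((15381 : ℚ) / 10000)) (E := ((12343 : ℚ) / 10000))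
      (q₁ := ((4747 : ℚ) / 10000)) (q₂ := ((8339 : ℚ) / 10000)) (by decide +kernel)
      (Δ := Δ') (tpd := 1) (tpp := b') (c := c') (by simpa using hΔ') (by simp) (by simpa using hb') (by simpa using hc')
    obtain ⟨-, -, -, -, -, hwin⟩ := h
    push_cast at hwin
    have ht := vhFrac_93_200
    have hmono := vhFrac_anti (show (93 / 200 : ℝ) ≤ ((4747 : ℝ) / 10000) by norm_num)
    have hnu : ((58647 : ℝ) / 147456) ≤ ((21 : ℝ) / 50) := by norm_num
    linarith [hwin.1, ht.2]
  have hEh := (fermiEnergyOf_of_pointBracketCheck faceDirPt_Hg1201P10_nH116_s2_lo_br (by norm_num) (by norm_num) (by norm_num) (ν := (21/50 : ℝ))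
    (by push_cast; exact ⟨le_rfl, le_rfl⟩)).2
  have hEv := (fermiEnergyOf_of_pointBracketCheck faceDirPt_Hg1201P10_nH116_s2_hi_br (by norm_num) (by norm_num) (by norm_num) (ν := (21/50 : ℝ))
    (by push_cast; exact ⟨le_rfl, le_rfl⟩)).2
  push_cast at hEh hEv
  refine dWeightFace_fermiEnergyOf_mem_Icc_of_mem_box3_dir_num (Eh := ((1651 : ℝ) / 1000)) (Ev := ((1569 : ℝ) / 1250)) (Elow := ((3113 : ℝ) / 2500)) (κ₀ := 1 / 10) (κ := 1 / 10)
    (by norm_num) one_pos (by norm_num) (by norm_num) (by norm_num) hΔn hbn hcn (by norm_num) (by norm_num) hVH hEh.2 (by norm_num)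
    (by norm_num [faceU, fsD, fsN, cA]) (by norm_num [faceU, fsD, fsN, cA]) (by norm_num [faceU, fsD, fsN, cA]) (by norm_num [faceU, fsD, fsN, cA])
    hEv.1 (by norm_num) (by norm_num) (by norm_num [faceG]) (by norm_num) (by norm_num) (by norm_num) le_rfl (by norm_num [dWeightAxisCF])
    (by norm_num) (by norm_num) ?_ (by norm_num [dWeightFaceLoDec, faceRUp, faceN]) (by norm_num [dWeightFaceCF, faceN, faceR, fsN])
  intro D B C e hD hB hC he hG
  exact faceDir_nonneg_of_mem_region ⟨le_trans (by norm_num) hD.1, le_trans hD.2 (by norm_num)⟩ ⟨le_trans (by norm_num) he.1, le_trans he.2 (by norm_num)⟩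
    ⟨le_trans (by norm_num) hB.1, le_trans hB.2 (by norm_num)⟩ ⟨le_trans (by norm_num) hC.1, le_trans hC.2 (by norm_num)⟩ hG

/-- **`emeryBoxHg1201P10 (EmeryBoxesPressure)`, ν = 21/50: for EVERY member θ the Cu-d weight of the antinodal Fermi-surface state lies in `[0.594, 0.7273]`** (hull of the 2 t_pd slab windows; regime-free rule v2). [folklore] -/
theorem hg1201P10Box_dWeightFaceDir_nH116 {Δ a b c : ℝ} (hΔ : Δ ∈ Icc ((23 : ℝ) / 20) ((5 : ℝ) / 2)) (ha : a ∈ Icc ((139 : ℝ) / 100) ((77 : ℝ) / 50)) (hb : b ∈ Icc ((17 : ℝ) / 25) ((79 : ℝ) / 100)) (hc : c ∈ Icc ((289 : ℝ) / 2500) ((289 : ℝ) / 2500)) :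
    dWeightFace Δ a b c (fermiEnergyOf Δ a b c ((21 : ℝ) / 50)) ∈ Icc ((297 : ℝ) / 500) ((7273 : ℝ) / 10000) := by
  rcases le_or_gt a ((293 : ℝ) / 200) with h1 | h1
  · have h := hg1201P10Box_dWeightFaceDir_nH116_s1 hΔ ⟨ha.1, h1⟩ hb hc
    exact ⟨le_trans (by norm_num) h.1, le_trans h.2 (by norm_num)⟩
  · have h := hg1201P10Box_dWeightFaceDir_nH116_s2 hΔ ⟨h1.le, ha.2⟩ hb hc
    exact ⟨le_trans (by norm_num) h.1, le_trans h.2 (by norm_num)⟩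

end Summit.Ventures.CertifiedManyBodySolver.Downfold.Emery
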